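import Literature.Probability.Percolation.BondTwoArmsBox
import Literature.Probability.Percolation.BondTwoPointLowerBound
import Literature.Probability.Percolation.ConnectivityProofs
import HarnessLib

/-!
# `PercFiniteBoxLRO.Cerf2015BoxLRO16` (stmt-CriticalPhenomena-0860), tools IV: Cerf's Lemma 10.1 and
# the connection geometry of §10 for BOND percolation on `ℤ^d` / `ℤ³`

Helper file (`--supports stmt-CriticalPhenomena-0860`), independent of the counting files: Lemma 10.1
(`theta_sq_le_real_bconn_add`: `θ(p)² ≤ P_p(a ↔ b in Λ(n+ℓ)) + P_p(twoArmsBox n ℓ a b)`, Harris–FKG for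
`{a ↔ ∞}`, `{b ↔ ∞}` and translation invariance), the symmetrisation from a boundary point to the even
axis points (`sq_le_real_bconn_axis`: signed permutation, reflection, Harris–FKG gluing — Cerf §10,
"By symmetry and the FKG inequality"), straight open segments (`pow_le_real_bconn_segment`,
`pow_le_real_bconn_single`), and the elementary bound `P_p(x ↔ y in Λ(n)) ≥ p^{6n}` for
`x, y ∈ Λ(n) ⊆ ℤ³` (`pow_le_real_bconn_box`) used for the finitely many small `n` and for `p = 1`.
This file introduces no definition.

## References

* R. Cerf, *A lower bound on the two-arms exponent for critical percolation on the lattice*, Ann.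
  Probab. 43 (2015) 2458–2480, arXiv:1306.3105 [Cerf2015].
-/

noncomputable section

namespace Summit.CriticalPhenomena.PercolationContinuityZ3.Theorems

namespace Cerf2015BoxLRO16

open Literature.Probability.Percolation Literature.Probability.Percolation.AKN
  Literature.Probability.Percolation.GM Literature.Probability.LatticeModels MeasureTheory Finset Real
open scoped Classical

variable {d : ℕ}

/-- **Cerf 2015, Lemma 10.1, bond version**: for `a, b ∈ Λ(n+ℓ)`,
`θ(p)² ≤ P_p(a ↔ b in Λ(n+ℓ)) + P_p(twoArmsBox n ℓ a b)` ("`P(x ↔ y in Λ(n+ℓ)) ≥ θ(p)² −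
P(two-arms(Λ(n),x,y,ℓ))`": Harris–FKG for `{a ↔ ∞}`, `{b ↔ ∞}`, translation invariance
`θ_a = θ_b = θ`, and an infinite cluster leaves the box). [cite: Cerf2015, Lem 10.1] -/
theorem theta_sq_le_real_bconn_add (p : unitInterval) {n ℓ : ℕ} {a b : Site d}
    (ha : a ∈ box d (n + ℓ)) (hb : b ∈ box d (n + ℓ)) :
    theta (zdGraph d) 0 p ^ 2 ≤ (bondPercolation (zdGraph d) p).real (bconn (box d (n + ℓ)) a b) +
      (bondPercolation (zdGraph d) p).real (twoArmsBox n ℓ a b) := by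
  set μ := bondPercolation (zdGraph d) p with hμ
  have hfkg := harris_fkg_holds (zdGraph d) p (isUpperSet_percolatesAt a) (isUpperSet_percolatesAt b)
    (measurableSet_percolatesAt_holds a) (measurableSet_percolatesAt_holds b)
  have hθa : μ.real (percolatesAt a) = theta (zdGraph d) 0 p := theta_zdGraph_eq_theta_zero p a
  have hθb : μ.real (percolatesAt b) = theta (zdGraph d) 0 p := theta_zdGraph_eq_theta_zero p b
  -- an infinite cluster at a point of the box reaches the boundary of the box
  have hreach : ∀ ω : BondConfig (Site d), ω ⊆ (zdGraph d).edgeSet → ∀ x ∈ box d (n + ℓ), ω ∈ percolatesAt x →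
      Reaches (zdGraph d) (box d (n + ℓ)) ω x := by
    intro ω hω x hx hinf
    obtain ⟨z, hz, hzN⟩ : ∃ z ∈ openCluster ω x, z ∉ box d (n + ℓ) := by
      by_contra hcon
      push Not at hcon
      exact hinf ((box d (n + ℓ)).finite_toSet.subset fun z hz => Finset.mem_coe.2 (hcon z hz))
    have hle : openGraph ω ≤ zdGraph d := fun u v huv => DCT16.adj_of_openGraph_adj hω huv
    have hz' : (openGraph ω ⊓ zdGraph d).Reachable x z := SimpleGraph.Reachable.mono (le_inf le_rfl hle) hz
    exact reaches_of_reachable le_rfl hx hz' (Or.inl hzN)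
  have hsub : ∀ ω : BondConfig (Site d), ω ⊆ (zdGraph d).edgeSet → ω ∈ percolatesAt a ∩ percolatesAt b →
      ω ∈ bconn (box d (n + ℓ)) a b ∪ twoArmsBox n ℓ a b := by
    intro ω hω ⟨hpa, hpb⟩
    by_cases hab : b ∈ openClusterIn (withinGraph (zdGraph d) ↑(box d (n + ℓ))) ω a
    · exact Or.inl hab
    · exact Or.inr ⟨hab, hreach ω hω a ha hpa, hreach ω hω b hb hpb⟩
  calc theta (zdGraph d) 0 p ^ 2 = μ.real (percolatesAt a) * μ.real (percolatesAt b) := by rw [hθa, hθb, sq]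
    _ ≤ μ.real (percolatesAt a ∩ percolatesAt b) := hfkg
    _ ≤ μ.real (bconn (box d (n + ℓ)) a b ∪ twoArmsBox n ℓ a b) :=
        DCT16.real_mono_of_forall_subset_edgeSet _ _ hsub
    _ ≤ _ := measureReal_union_le _ _

/-- **Axis points** (Cerf 2015, §10: "Suppose for instance that `x_n` belongs to `{n} × ℤ^{d−1}` … By
symmetry and the FKG inequality, `P(0 ↔ 2ne₁ in Λ(4n+n^α)) ≥ P(0 ↔ x_n in Λ(n+n^α))²`"), bond version:
if `b ∈ ∂ⁱⁿΛ(n)` and `P_p(0 ↔ b in Λ(R)) ≥ η ≥ 0`, then `P_p(0 ↔ 2σn e_j in Λ(R+2n)) ≥ η²` for every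
axis `j` and sign `σ` (signed permutation, reflection in the hyperplane through the image of `b`,
Harris–FKG gluing). [cite: Cerf2015, §10] -/
theorem sq_le_real_bconn_axis (p : unitInterval) {n R : ℕ} {b : Site d}
    (hb : b ∈ innerBoundary (zdGraph d) (box d n)) {η : ℝ} (hη0 : 0 ≤ η)
    (hη : η ≤ (bondPercolation (zdGraph d) p).real (bconn (box d R) 0 b)) (j : Fin d) (s : ℤˣ) :
    η ^ 2 ≤ (bondPercolation (zdGraph d) p).real (bconn (box d (R + 2 * n)) 0 (Pi.single j ((s : ℤ) * (2 * n)))) := by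
  set μ := bondPercolation (zdGraph d) p with hμ
  obtain ⟨i, hi⟩ := exists_eq_of_mem_innerBoundary_box hb
  obtain ⟨t, ht⟩ : ∃ t : ℤˣ, (t : ℤ) * b i = (s : ℤ) * n := by
    rcases hi with h | h
    · exact ⟨s, by rw [h]⟩
    · exact ⟨-s, by rw [h, Units.val_neg]; ring⟩
  set x' : Site d := Site.signedPerm (Equiv.swap i j) (fun _ => t) b with hx'
  have hx'j : x' j = (s : ℤ) * n := by
    rw [hx', Site.signedPerm_apply, Equiv.symm_swap, Equiv.swap_apply_right]; exact ht
  have hsym : μ.real (bconn (box d R) 0 x') = μ.real (bconn (box d R) 0 b) := real_bconn_signedPerm p R _ _ b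
  have hrefl := real_bconn_reflect p R x' j
  have h2 : 2 * x' j = (s : ℤ) * (2 * n) := by rw [hx'j]; ring
  rw [h2] at hrefl
  set v : Site d := Pi.single j ((s : ℤ) * (2 * n)) with hv
  have hS : box d R ⊆ box d R ∪ (box d R).image (· + v) := Finset.subset_union_left
  have hS' : (box d R).image (· + v) ⊆ box d R ∪ (box d R).image (· + v) := Finset.subset_union_right
  have hglue := real_bconn_mul_le p hS hS' 0 x' v
  rw [hrefl, hsym] at hglue
  have hsabs : (s : ℤ) = 1 ∨ (s : ℤ) = -1 := by
    rcases Int.units_eq_one_or s with hs | hs <;> simp [hs]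
  have hT : box d R ∪ (box d R).image (· + v) ⊆ box d (R + 2 * n) := by
    intro y hy
    rcases Finset.mem_union.1 hy with hy | hy
    · exact box_mono d (Nat.le_add_right _ _) hy
    · obtain ⟨z, hz, rfl⟩ := Finset.mem_image.1 hy
      rw [mem_box] at hz ⊢
      intro k
      have hzk := hz k
      rw [Pi.add_apply, hv]
      by_cases hkj : k = j
      · subst hkj
        rw [Pi.single_eq_same]
        push_cast
        rcases hsabs with hs | hs <;> rw [hs] <;> constructor <;> linarith [hzk.1, hzk.2]
      · rw [Pi.single_eq_of_ne hkj, add_zero]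
        push_cast
        constructor <;> linarith [hzk.1, hzk.2]
  have hmono : μ.real (bconn (box d R ∪ (box d R).image (· + v)) 0 v) ≤ μ.real (bconn (box d (R + 2 * n)) 0 v) :=
    measureReal_mono (openConnVia_mono_graph (withinGraph_mono _ (Finset.coe_subset.2 hT)) 0 v) (measure_ne_top _ _)
  calc η ^ 2 = η * η := sq η
    _ ≤ μ.real (bconn (box d R) 0 b) * μ.real (bconn (box d R) 0 b) := mul_le_mul hη hη hη0 measureReal_nonneg
    _ ≤ _ := hglue
    _ ≤ _ := hmono

/-- A lattice segment with endpoints in a box lies in the box. [folklore] -/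
theorem add_single_mem_box_of_le {B : ℕ} {u : Site d} {j : Fin d} {s : ℤˣ} {k : ℕ} (hu : u ∈ box d B)
    (huk : u + Pi.single j ((s : ℤ) * k) ∈ box d B) {i : ℕ} (hi : i ≤ k) :
    u + Pi.single j ((s : ℤ) * i) ∈ box d B := by
  rw [mem_box] at hu huk ⊢
  intro l
  have h1 := hu l
  have h2 := huk l
  rw [Pi.add_apply] at h2 ⊢
  by_cases hlj : l = j
  · subst hlj
    rw [Pi.single_eq_same] at h2 ⊢
    have hik : (i : ℤ) ≤ k := by exact_mod_cast hi
    have hi0 : (0 : ℤ) ≤ i := by positivity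
    rcases Int.units_eq_one_or s with hs | hs <;> simp only [hs, Units.val_one, Units.val_neg, one_mul, neg_mul] at h2 ⊢ <;>
      constructor <;> linarith [h1.1, h1.2, h2.1, h2.2]
  · rw [Pi.single_eq_of_ne hlj, add_zero]
    exact h1

/-- **A straight segment of `k` edges inside `S` is open with probability at least `p^k`**
(Harris–FKG, one edge at a time; Cerf 2015, §10: "the probability of connection between `z` and `y`
is larger than `p^d`"). [cite: Cerf2015, §6 and §10] -/
theorem pow_le_real_bconn_segment (p : unitInterval) (S : Finset (Site d)) (u : Site d) (j : Fin d) (s : ℤˣ) :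
    ∀ k : ℕ, (∀ i ≤ k, u + Pi.single j ((s : ℤ) * i) ∈ S) →
      (p : ℝ) ^ k ≤ (bondPercolation (zdGraph d) p).real (bconn S u (u + Pi.single j ((s : ℤ) * k))) := by
  intro k
  induction k with
  | zero =>
    intro _
    simp only [Nat.cast_zero, mul_zero, Pi.single_zero, add_zero, pow_zero]
    exact (real_bconn_self p S u).symm.le
  | succ k ih =>
    intro hmem
    have hk := ih fun i hi => hmem i (hi.trans (Nat.le_succ k))
    have hv : u + Pi.single j ((s : ℤ) * k) ∈ S := hmem k (Nat.le_succ k)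
    have hw : u + Pi.single j ((s : ℤ) * (k + 1 : ℕ)) ∈ S := hmem (k + 1) le_rfl
    have hadj : (zdGraph d).Adj (u + Pi.single j ((s : ℤ) * k)) (u + Pi.single j ((s : ℤ) * (k + 1 : ℕ))) := by
      rw [zdGraph_adj_iff]
      refine ⟨j, ?_⟩
      rcases Int.units_eq_one_or s with hs | hs
      · left
        have e : (1 : ℤ) * ((k + 1 : ℕ) : ℤ) = 1 * (k : ℤ) + 1 := by push_cast; ring
        rw [hs, Units.val_one, e, Pi.single_add, add_assoc]
      · right
        have e : (-1 : ℤ) * (k : ℤ) = -1 * ((k + 1 : ℕ) : ℤ) + 1 := by push_cast; ring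
        rw [hs, Units.val_neg, Units.val_one, e, Pi.single_add, add_assoc]
    have h := real_bconn_adj_le p hadj hv hw (x := u)
    calc (p : ℝ) ^ (k + 1) = (p : ℝ) * (p : ℝ) ^ k := by ring
      _ ≤ (p : ℝ) * (bondPercolation (zdGraph d) p).real (bconn S u (u + Pi.single j ((s : ℤ) * k))) :=
          mul_le_mul_of_nonneg_left hk p.2.1
      _ ≤ _ := h

/-- Every integer is `± k`. [folklore] -/
theorem exists_units_mul_natCast (z : ℤ) : ∃ (s : ℤˣ) (k : ℕ), z = (s : ℤ) * k ∧ (k : ℤ) = |z| := by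
  rcases le_or_gt 0 z with hz | hz
  · exact ⟨1, z.toNat, by rw [Units.val_one, one_mul, Int.toNat_of_nonneg hz], by rw [Int.toNat_of_nonneg hz, abs_of_nonneg hz]⟩
  · refine ⟨-1, (-z).toNat, ?_, ?_⟩
    · rw [Units.val_neg, Units.val_one, Int.toNat_of_nonneg (by omega)]; ring
    · rw [Int.toNat_of_nonneg (by omega), abs_of_neg hz]

/-- **Axis points from the origin**: `P_p(0 ↔ z e_j in Λ(B)) ≥ p^{|z|}` for `|z| ≤ B`.
[cite: Cerf2015, §10] -/
theorem pow_le_real_bconn_single (p : unitInterval) {B : ℕ} (j : Fin d) (s : ℤˣ) {k : ℕ} (hk : k ≤ B) :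
    (p : ℝ) ^ k ≤ (bondPercolation (zdGraph d) p).real (bconn (box d B) 0 (Pi.single j ((s : ℤ) * k))) := by
  have h := pow_le_real_bconn_segment p (box d B) 0 j s k ?_
  · rwa [zero_add] at h
  · intro i hi
    rw [zero_add, mem_box]
    intro l
    by_cases hlj : l = j
    · subst hlj
      rw [Pi.single_eq_same]
      have : (i : ℤ) ≤ B := by exact_mod_cast hi.trans hk
      rcases Int.units_eq_one_or s with hs | hs <;> simp [hs] <;> omega
    · rw [Pi.single_eq_of_ne hlj]; simp

/-- `32768 n ≤ n^16` for `n ≥ 2`. [folklore] -/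
theorem pow_sixteen_ge {n : ℕ} (hn : 2 ≤ n) : 32768 * n ≤ n ^ 16 := by
  calc 32768 * n = 2 ^ 15 * n := by norm_num
    _ ≤ n ^ 15 * n := Nat.mul_le_mul_right n (Nat.pow_le_pow_left hn 15)
    _ = n ^ 16 := by ring

/-- **Small boxes** (the case `n < N`, Cerf 2015, §10: "Since `N` is fixed, this lower bound can be
extended to every `n ≥ 1` by taking a smaller value of `ρ`"): for `x, y ∈ Λ(n)`,
`P_p(x ↔ y in Λ(n)) ≥ p^{6n}` (three straight segments inside `Λ(n)`, Harris–FKG).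
[cite: Cerf2015, §10] -/
theorem pow_le_real_bconn_box (p : unitInterval) {n : ℕ} {x y : Site 3} (hx : x ∈ box 3 n) (hy : y ∈ box 3 n) :
    (p : ℝ) ^ (6 * n) ≤ (bondPercolation (zdGraph 3) p).real (bconn (box 3 n) x y) := by
  set μ := bondPercolation (zdGraph 3) p with hμ
  have hp0 : (0 : ℝ) ≤ p := p.2.1
  -- a leg: move coordinate `i` of `u ∈ Λ(n)` to the value `c ∈ [-n, n]`
  have hleg : ∀ u : Site 3, u ∈ box 3 n → ∀ i : Fin 3, ∀ c : ℤ, -(n : ℤ) ≤ c → c ≤ n →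
      (p : ℝ) ^ (2 * n) ≤ μ.real (bconn (box 3 n) u (u + Pi.single i (c - u i))) := by
    intro u hu i c hc1 hc2
    have hui := (mem_box.1 hu) i
    obtain ⟨s, k, hk, hkabs⟩ := exists_units_mul_natCast (c - u i)
    have hend : u + Pi.single i ((s : ℤ) * k) ∈ box 3 n := by
      rw [← hk, mem_box]; intro l
      rw [Pi.add_apply]
      by_cases hli : l = i
      · subst hli; rw [Pi.single_eq_same]; constructor <;> linarith
      · rw [Pi.single_eq_of_ne hli, add_zero]; exact (mem_box.1 hu) l
    have hseg := pow_le_real_bconn_segment p (box 3 n) u i s k (fun i' hi' => add_single_mem_box_of_le hu hend hi')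
    rw [← hk] at hseg
    have hk2n : k ≤ 2 * n := by
      have : (k : ℤ) ≤ 2 * n := by rw [hkabs, abs_le]; constructor <;> linarith [hui.1, hui.2]
      omega
    exact (pow_le_pow_of_le_one hp0 p.2.2 hk2n).trans hseg
  have hyb := mem_box.1 hy
  set z₁ : Site 3 := x + Pi.single 0 (y 0 - x 0) with hz₁
  set z₂ : Site 3 := z₁ + Pi.single 1 (y 1 - z₁ 1) with hz₂
  have hyz : y = z₂ + Pi.single 2 (y 2 - z₂ 2) := by
    funext l; fin_cases l <;> simp [hz₂, hz₁]
  have hz₁mem : z₁ ∈ box 3 n := by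
    have hxb := mem_box.1 hx
    rw [mem_box]; intro l; fin_cases l <;> simp [hz₁, hxb 1, hxb 2, hyb 0]
  have hz₂mem : z₂ ∈ box 3 n := by
    have hxb := mem_box.1 hx
    rw [mem_box]; intro l; fin_cases l <;> simp [hz₂, hz₁, hxb 2, hyb 0, hyb 1]
  have hleg0 := hleg x hx 0 (y 0) (hyb 0).1 (hyb 0).2
  have hleg1 := hleg z₁ hz₁mem 1 (y 1) (hyb 1).1 (hyb 1).2
  have hleg2 := hleg z₂ hz₂mem 2 (y 2) (hyb 2).1 (hyb 2).2
  rw [← hyz] at hleg2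
  have h01 := real_bconn_mul_le p (subset_refl (box 3 n)) (subset_refl _) x z₁ z₂
  have h012 := real_bconn_mul_le p (subset_refl (box 3 n)) (subset_refl _) x z₂ y
  have hpn : 0 ≤ (p : ℝ) ^ (2 * n) := by positivity
  calc (p : ℝ) ^ (6 * n) = (p : ℝ) ^ (2 * n) * (p : ℝ) ^ (2 * n) * (p : ℝ) ^ (2 * n) := by rw [← pow_add, ← pow_add]; ring_nf
    _ ≤ μ.real (bconn (box 3 n) x z₁) * μ.real (bconn (box 3 n) z₁ z₂) * μ.real (bconn (box 3 n) z₂ y) :=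
        mul_le_mul (mul_le_mul hleg0 hleg1 hpn measureReal_nonneg) hleg2 hpn
          (mul_nonneg measureReal_nonneg measureReal_nonneg)
    _ ≤ μ.real (bconn (box 3 n) x z₂) * μ.real (bconn (box 3 n) z₂ y) := mul_le_mul_of_nonneg_right h01 measureReal_nonneg
    _ ≤ μ.real (bconn (box 3 n) x y) := h012

end Cerf2015BoxLRO16

end Summit.CriticalPhenomena.PercolationContinuityZ3.Theorems

end
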